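import Summits.CriticalPhenomena.PercolationContinuityZ3.Theorems.Transplant.FKConnectivityAllQPat3BridgeB0KDataD
import Summits.CriticalPhenomena.PercolationContinuityZ3.Theorems.Transplant.FKConnectivityAllQPat3BridgeKDataB1
import Summits.CriticalPhenomena.PercolationContinuityZ3.Theorems.Transplant.FKConnectivityAllQPat3BridgeKDataB2
import Summits.CriticalPhenomena.PercolationContinuityZ3.Theorems.Transplant.FKConnectivityAllQPat3BridgeLeafB0
import Summits.CriticalPhenomena.PercolationContinuityZ3.Theorems.Transplant.FKConnectivityAllQPat3BridgeLeafB12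
import HarnessLib

/-!
# Connectivity correlation inequalities for `φ_{w,q}`, every `q > 0` — THE BRIDGE 𝒯₂-LEAVES B0 / B1 / B2 IN ALL {free, contracted}
# STATES (census g41: the leaf lemmas of THEOREM 𝒯₂(𝒦) in the (E, C)-minor form)

Proof file (`--supports stmt-CriticalPhenomena-4575`), census lineage (gen 41) of LANE 2's FK sub-programme; builds on p205010 (kernel
theorem, internal audit signed; external expert review pending).  No definitions, no named facts, no sorries; standard axioms.

Census g39's 𝒯₂-leaves of the BRIDGE case (memo HOME/FROM-census-g39-SP-W4FREE.md §3), in the minor form with a free part `L` and a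
contracted part `K` of the plain slots, `(L, K) ∈ FK.splits skel` (census g41, memo HOME/FROM-census-g41-*.md): for EVERY member of
`FK.famP11` (index `n`; members beyond the list are the zero table) and every level,
* **`FK.bridgeB0Kc_famP11_level_nonneg` / `FK.bridgeB0Kd_famP11_level_nonneg`** (t = 0): `0 ≤ lev2C (plainSet p L) (plainSet p K)
  (p 0) (p 1) (p 2 | p 3) (famGet famP11 n) μ` for four injective names — the explicit minors of `K₄ − ab`, inner mark at `c` / at `d`
  (`FK.shape0K_nonneg_of_check` + `…Pat3BridgeB0KData`);
* **`FK.bridgeB1K_famP11_level_nonneg` / `FK.bridgeB2K_famP11_level_nonneg`** (t = 1): the slot `ac` (resp. `cd`) carries a piece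
  MINOR `(E_Q, C_Q)` on `V_Q` with inner mark `p 4` on which `famP11` is levelwise nonnegative at `(p 0, p 2, p 4)` (resp.
  `(p 2, p 3, p 4)`); then `famP11` is levelwise nonnegative at `(p 0, p 1, p 4)` on `(plainSet p L ∪ E_Q, plainSet p K ∪ C_Q)`
  (`FK.shape1KC_nonneg_of_cert` + `…Pat3BridgeKDataB1/B2`).
The all-free states `(skel, [])` are census g40's `…Pat3BridgeLeafB0/B12` lemmas member by member.
[cite: AyyerLinussonRavichandran2025, §7 (p. 22)]
-/

namespace Summit.CriticalPhenomena.PercolationContinuityZ3.Theorems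

namespace FK

open SimpleGraph Literature.Probability.LatticeModels Literature.Probability.Percolation
open scoped Classical

variable {V : Type*}

section Leaves

variable [Fintype V]

omit [Fintype V] in
/-- Members of `famP11` beyond the list are the zero table, levelwise nonnegative on anything. [folklore] -/
theorem lev2C_famP11_nonneg_of_le (E C : Finset (Sym2 V)) (x y s : V) {n : ℕ} (hn : 11 ≤ n) (μ : ℕ) :
    0 ≤ lev2C E C x y s (famGet famP11 n) μ := by
  rw [famGet_of_le (show famP11.length ≤ n from hn)]
  exact lev2C_nonneg_of_coef E C x y s (fun _ _ _ => le_rfl) μ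

/-! ### B0: the explicit minors of `K₄ − ab` (t = 0) -/

/-- **LEAF B0 IN ALL STATES, inner mark `c`**: four injective names `a b c d = p 0 … p 3`, plain slots split into free `L` and
contracted `K`; every `famP11` member is levelwise nonnegative at `(a, b, c)` on `(plainSet p L, plainSet p K)`.
[cite: AyyerLinussonRavichandran2025, §7 (p. 22)] -/
theorem bridgeB0Kc_famP11_level_nonneg {p : Fin 4 → V} (hinj : Function.Injective p) {L K : List (Fin 4 × Fin 4)}
    (hLK : (L, K) ∈ splits skelB0) (n μ : ℕ) : 0 ≤ lev2C (plainSet p L) (plainSet p K) (p 0) (p 1) (p 2) (famGet famP11 n) μ := by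
  by_cases hn : n < 11
  · exact shape0K_nonneg_of_check hinj rfl rfl rfl (splits_forall hLK (skelB0_ne hinj)).1
      (splits_nodup_left hLK (skelB0_nodup hinj)) (bridgeB0Kc_checks (L, K) hLK n hn) μ
  · exact lev2C_famP11_nonneg_of_le _ _ _ _ _ (not_lt.1 hn) μ

/-- **LEAF B0 IN ALL STATES, inner mark `d`.** [cite: AyyerLinussonRavichandran2025, §7 (p. 22)] -/
theorem bridgeB0Kd_famP11_level_nonneg {p : Fin 4 → V} (hinj : Function.Injective p) {L K : List (Fin 4 × Fin 4)}
    (hLK : (L, K) ∈ splits skelB0) (n μ : ℕ) : 0 ≤ lev2C (plainSet p L) (plainSet p K) (p 0) (p 1) (p 3) (famGet famP11 n) μ := by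
  by_cases hn : n < 11
  · exact shape0K_nonneg_of_check hinj rfl rfl rfl (splits_forall hLK (skelB0_ne hinj)).1
      (splits_nodup_left hLK (skelB0_nodup hinj)) (bridgeB0Kd_checks (L, K) hLK n hn) μ
  · exact lev2C_famP11_nonneg_of_le _ _ _ _ _ (not_lt.1 hn) μ

/-! ### B1 / B2: one marked slot (t = 1) -/

variable {p : Fin 5 → V} {EQ CQ : Finset (Sym2 V)} {VQ : Set V} {L K : List (Fin 5 × Fin 5)}

/-- **LEAF B1 IN ALL STATES**: names `a b c d = p 0 … p 3`, the piece minor `(E_Q, C_Q)` in the slot `ac` (names `0, 2`, inner mark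
`p 4`, vertex set `V_Q`) carrying `famP11` levelwise nonnegative at `(p 0, p 2, p 4)`, the other four slots split into free `L` and
contracted `K`; then every `famP11` member is levelwise nonnegative at `(a, b, p 4)` on `(plainSet p L ∪ E_Q, plainSet p K ∪ C_Q)`.
[cite: AyyerLinussonRavichandran2025, §7 (p. 22)] -/
theorem bridgeB1K_famP11_level_nonneg (hinj : Function.Injective p) (hLK : (L, K) ∈ splits skelB1)
    (hQ : ∀ e ∈ (↑(EQ ∪ CQ) : Set (Sym2 V)), ∀ z ∈ e, z ∈ VQ) (hmQ : p 4 ∈ VQ)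
    (hp : ∀ a, p a ∈ VQ → p a = p 0 ∨ p a = p 2 ∨ p a = p 4) (hdQ : Disjoint (plainSet p skelB1) EQ)
    (hval : ∀ n ν, 0 ≤ lev2C EQ CQ (p 0) (p 2) (p 4) (famGet famP11 n) ν) (n μ : ℕ) :
    0 ≤ lev2C (plainSet p L ∪ EQ) (plainSet p K ∪ CQ) (p 0) (p 1) (p 4) (famGet famP11 n) μ := by
  by_cases hn : n < 11
  · obtain ⟨cert, Dn, hDn, hc⟩ := bridgeB1K_certs (L, K) hLK n hn
    have hlen := splits_length hLK
    have hlen' : skelB1.length = 4 := rfl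
    exact shape1KC_nonneg_of_cert hinj hQ (hinj.ne (by decide)) hmQ (hinj.ne (by decide)) (hinj.ne (by decide)) hp
      rfl rfl rfl rfl rfl rfl (splits_forall hLK (skelB1_ne hinj)).1 (splits_nodup_left hLK (skelB1_nodup hinj))
      (splits_forall hLK (skelB1_mark hinj)).1 (splits_forall hLK (skelB1_mark hinj)).2
      (Finset.disjoint_of_subset_left (plainSet_subset_of_splits hLK) hdQ) _ hDn (by omega) hc (fun n _ ν => hval n ν) μ
  · exact lev2C_famP11_nonneg_of_le _ _ _ _ _ (not_lt.1 hn) μ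

/-- **LEAF B2 IN ALL STATES**: as B1 with the piece minor in the slot `cd` (names `2, 3`), `famP11` levelwise nonnegative on it at
`(p 2, p 3, p 4)`. [cite: AyyerLinussonRavichandran2025, §7 (p. 22)] -/
theorem bridgeB2K_famP11_level_nonneg (hinj : Function.Injective p) (hLK : (L, K) ∈ splits skelB2)
    (hQ : ∀ e ∈ (↑(EQ ∪ CQ) : Set (Sym2 V)), ∀ z ∈ e, z ∈ VQ) (hmQ : p 4 ∈ VQ)
    (hp : ∀ a, p a ∈ VQ → p a = p 2 ∨ p a = p 3 ∨ p a = p 4) (hdQ : Disjoint (plainSet p skelB2) EQ)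
    (hval : ∀ n ν, 0 ≤ lev2C EQ CQ (p 2) (p 3) (p 4) (famGet famP11 n) ν) (n μ : ℕ) :
    0 ≤ lev2C (plainSet p L ∪ EQ) (plainSet p K ∪ CQ) (p 0) (p 1) (p 4) (famGet famP11 n) μ := by
  by_cases hn : n < 11
  · obtain ⟨cert, Dn, hDn, hc⟩ := bridgeB2K_certs (L, K) hLK n hn
    have hlen := splits_length hLK
    have hlen' : skelB2.length = 4 := rfl
    exact shape1KC_nonneg_of_cert hinj hQ (hinj.ne (by decide)) hmQ (hinj.ne (by decide)) (hinj.ne (by decide)) hp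
      rfl rfl rfl rfl rfl rfl (splits_forall hLK (skelB2_ne hinj)).1 (splits_nodup_left hLK (skelB2_nodup hinj))
      (splits_forall hLK (skelB2_mark hinj)).1 (splits_forall hLK (skelB2_mark hinj)).2
      (Finset.disjoint_of_subset_left (plainSet_subset_of_splits hLK) hdQ) _ hDn (by omega) hc (fun n _ ν => hval n ν) μ
  · exact lev2C_famP11_nonneg_of_le _ _ _ _ _ (not_lt.1 hn) μ

end Leaves

end FK

end Summit.CriticalPhenomena.PercolationContinuityZ3.Theorems
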